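import Mathlib
import HarnessLib
import Summits.QuantumAdvantage.QuantumAdvantage.Theorems.GapLawA

/-!
# The GAP LAW (part B of 2): a fixed firing set with a cut-free window of `3D + 2` bits wins on no non-zero set of degree `≤ D`

Cell `decomp-qadv`, lens 4 (minimal counterexample / extremal), generation 26, third node: the ZERO-ERROR
VISIT-PARITY ELIMINATION for gapped firing sets, and the structure theorem «a perfect low-degree level set fires
EVERYWHERE DENSELY».

SETTING (u-walk game, `AdviceFreeQNC0.WalkTransport`): board `(n, c)`, cuts `g ∈ {0, …, n}`, cut `g` is live at
`u ∈ {0,1}ⁿ` iff `c + g + |u| + W_g(u) ≢ 0 (mod 3)` (`W_g` = `wtPrefix`, the weight of the bits `< g`); a set of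
fired cuts WINS at `u` iff an odd number of them is live.  Here the fired set is a FIXED set `Y` (`liveCountY`,
`winY`) — the situation on a level set of a strategy reading finitely many features, where the fired set is constant
(`ringWinU_eq_winY`).

THE THREE PARITIES ALONG A GAP (`exists_even_class`).  Let `B = [a, a + ℓ)` be a window of bit positions that no
cut of `Y` separates: every `h ∈ Y` has `h ≤ a` or `h ≥ a + ℓ`.  Fix the bits outside `B` (`windowGlue a ℓ z ·`) and
let `b = |w| (mod 3)` be the weight class of the window bits `w`.  A cut `h ≤ a` does not see the window in its
prefix, so it is live iff `q_h + b ≢ 0`; a cut `h ≥ a + ℓ` sees all of it, so it is live iff `q_h + 2b ≢ 0`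
(`q_h` a constant of the slice; `live_windowGlue_iff`).  Either way `h` is dead for EXACTLY ONE of the three classes
`b`, so the three live counts `N(0), N(1), N(2)` sum to `2·#Y`: they are never all odd.  Hence in every slice a
whole weight class of the window consists of LOSSES of `Y`.

THE IMMUNITY STEP (Beck–Li 2013 Thm 5.2 = the tree's `eq_zero_of_lowDegOn_of_forall_dvd_hwt`, cited BY NAME;
= `PhaseParity.eq_zero_of_lowDeg_vanish_class`): a function of degree `≤ D` on `{0,1}^ℓ`, `3D + 2 ≤ ℓ`, vanishing on a weight
class mod `3` is zero (any field with `3 ≠ 0`).  Restriction to a slice keeps the degree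
(`WalkTransport.comp_mem_lowDeg_of_coord`, `comp_windowGlue_mem_lowDeg`).

THE GAP LAW (`gap_law`, any field with `3 ≠ 0`): if `f` has degree `≤ D`, the fixed set `Y` wins at every point
where `f ≠ 0`, and `Y` leaves a cut-free window of `ℓ ≥ 3D + 2` bits, then `f = 0`.  COROLLARIES: a perfect
strategy that fires the constant set `Y` on a non-empty level set `{P = 1}` of `𝔽_p`-degree `≤ D` (`p ≠ 3`) fires
DENSELY there — `Y` meets every window `(a, a + 3D + 2)` (`perfect_levelSet_dense`, `levelSet_false_of_perfect_gap`);
and a strategy supported on a set `S` of cuts leaving a cut-free window of `3·#S·d + 2` bits is not perfect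
(`exists_loss_of_sparse_window` — the perfect-strategy form of the cell's sparse rung, in ten lines).

WHAT THIS IS / IS NOT.  It is the zero-error form of the cell's visit-parity elimination (`FeatOfVPE`: the dense
core of the `𝔽_p` walk game) for GAPPED firing sets, unconditional and for every `p ≠ 3` at once (false at `p = 3`
only through the degree bound: `walkEasyThree` fires `{0}` or `{1}`, gapped, on level sets of degree `n/1`).  It does
NOT prove the residual `X = AbsorptionDial.NoPerfectPolyOdd`: a general low-degree strategy has no low-degree level
sets with constant fired set, and a level set whose fired set is `(3D+2)`-dense (consecutive fired cuts closer than
the immunity length) escapes the slicing — DENSE FIRING is the residual this node leaves (memo NODE-g26 §9).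
PART B (this file): §5 `gap_law`, `dense_of_win`, `levelSet_false_of_perfect_gap`, `perfect_levelSet_dense`; §6
`exists_loss_of_sparse_window` (degree of a pattern class via `Smolensky.prod_mem_lowDeg`).  Part A: slices and parities.
Theses-free; no `sorry`; no instances, no notation.
-/


set_option autoImplicit false
set_option linter.dupNamespace false

namespace Summit.QuantumAdvantage.QuantumAdvantage.Theorems.GapLaw
open Classical
open Finset
open Summit.QuantumAdvantage.AdviceFreeQNC0
open Summit.QuantumAdvantage.QuantumAdvantage.Theorems.PhaseParity
open Literature.Computability.MetaComplexity Literature.Computability.MetaComplexity.Smolensky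

/-! ### §5 The gap law and its corollaries -/

section Law

variable {n : ℕ}

/-- **THE GAP LAW** (any field with `3 ≠ 0`).  If `f` has degree `≤ D`, the fixed firing set `Y` wins at every
point of `{f ≠ 0}`, and `Y` leaves a cut-free window `[a, a + ℓ)` of `ℓ ≥ 3D + 2` bits (every `h ∈ Y` has
`h ≤ a` or `h ≥ a + ℓ`), then `f = 0`. -/
theorem gap_law {F : Type*} [Field F] (h3 : (3 : F) ≠ 0) {D a ℓ : ℕ} (hℓ : 3 * D + 2 ≤ ℓ) (ha : a + ℓ ≤ n)
    (c : ℕ) (Y : Finset (Fin (n + 1))) (hgap : ∀ h ∈ Y, h.val ≤ a ∨ a + ℓ ≤ h.val) {f : CubeFn F n}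
    (hf : f ∈ lowDeg F n D) (hwin : ∀ u, f u ≠ 0 → winY c Y u = true) : f = 0 := by
  funext u
  obtain ⟨b, hb3, hb⟩ := exists_losing_windowClass c a ℓ (by omega) ha Y hgap u
  have hvan : ∀ w : Fin ℓ → Bool, wt w % 3 = b % 3 → f (windowGlue a ℓ u w) = 0 := by
    intro w hw
    by_contra hne
    have h1 := hwin _ hne
    rw [hb w (by omega)] at h1
    exact Bool.false_ne_true h1
  have hzero := eq_zero_of_lowDeg_vanish_class h3 b hℓ (comp_windowGlue_mem_lowDeg a ℓ u hf) hvan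
  have hu := congrFun hzero (blockBits a ℓ ha u)
  simp only [windowGlue_blockBits, Pi.zero_apply] at hu
  exact hu

/-- **Density of a winning level set.**  If `f ≠ 0` has degree `≤ D` and the fixed set `Y` wins on `{f ≠ 0}`,
then `Y` meets every window: for every `a` with `a + ℓ ≤ n`, `ℓ ≥ 3D + 2`, some `h ∈ Y` has `a < h < a + ℓ`. -/
theorem dense_of_win {F : Type*} [Field F] (h3 : (3 : F) ≠ 0) {D ℓ : ℕ} (hℓ : 3 * D + 2 ≤ ℓ) (c : ℕ)
    (Y : Finset (Fin (n + 1))) {f : CubeFn F n} (hf : f ∈ lowDeg F n D) (hne : f ≠ 0)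
    (hwin : ∀ u, f u ≠ 0 → winY c Y u = true) :
    ∀ a, a + ℓ ≤ n → ∃ h ∈ Y, a < h.val ∧ h.val < a + ℓ := by
  intro a ha
  by_contra hno
  push Not at hno
  exact hne (gap_law h3 hℓ ha c Y (fun h hh => by have := hno h hh; omega) hf hwin)

/-- **Level sets of a perfect strategy (𝔽_p, `p ≠ 3`).**  If a strategy `y` wins everywhere on a Boolean level set
`{P = 1}` of `𝔽_p`-degree `≤ D` on which it fires the constant set `Y`, and `Y` leaves a cut-free window of
`3D + 2` bits, then the level set is EMPTY. -/
theorem levelSet_false_of_perfect_gap (p : ℕ) [Fact p.Prime] (hp3 : p ≠ 3) {D a ℓ : ℕ}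
    (hℓ : 3 * D + 2 ≤ ℓ) (ha : a + ℓ ≤ n) (c : ℕ) (y : Fin (n + 1) → (Fin n → Bool) → Bool)
    (P : (Fin n → Bool) → Bool) (hP : HasDegF p P D) (Y : Finset (Fin (n + 1)))
    (hfire : ∀ u, P u = true → ∀ g, (y g u = true ↔ g ∈ Y))
    (hperf : ∀ u, P u = true → ringWinU c y u = true)
    (hgap : ∀ h ∈ Y, h.val ≤ a ∨ a + ℓ ≤ h.val) : ∀ u, P u = false := by
  have hwin : ∀ u, (fun u => if P u then (1 : ZMod p) else 0) u ≠ 0 → winY c Y u = true := by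
    intro u hu
    have hPu : P u = true := by
      by_contra hf
      exact hu (by simp [hf])
    rw [← ringWinU_eq_winY c y Y u (hfire u hPu)]
    exact hperf u hPu
  have hzero := gap_law (three_ne_zero_zmod_of_ne p hp3) hℓ ha c Y hgap hP hwin
  intro u
  by_contra hPu
  have hPu' : P u = true := by simpa using hPu
  have h1 := congrFun hzero u
  simp only [hPu', if_true, Pi.zero_apply] at h1
  exact one_ne_zero h1

/-- **A perfect level set fires densely.**  A strategy winning everywhere on a NON-EMPTY level set `{P = 1}` of
`𝔽_p`-degree `≤ D` (`p ≠ 3`) with constant fired set `Y` there has a fired cut strictly inside every window of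
`3D + 2` bit positions: `∀ a ≤ n - (3D+2), ∃ h ∈ Y, a < h < a + 3D + 2`. -/
theorem perfect_levelSet_dense (p : ℕ) [Fact p.Prime] (hp3 : p ≠ 3) {D : ℕ} (c : ℕ)
    (y : Fin (n + 1) → (Fin n → Bool) → Bool) (P : (Fin n → Bool) → Bool) (hP : HasDegF p P D)
    (Y : Finset (Fin (n + 1))) (hfire : ∀ u, P u = true → ∀ g, (y g u = true ↔ g ∈ Y))
    (hperf : ∀ u, P u = true → ringWinU c y u = true) (hne : ∃ u, P u = true) :
    ∀ a, a + (3 * D + 2) ≤ n → ∃ h ∈ Y, a < h.val ∧ h.val < a + (3 * D + 2) := by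
  intro a ha
  by_contra hno
  push Not at hno
  obtain ⟨u, hu⟩ := hne
  have := levelSet_false_of_perfect_gap p hp3 (le_refl _) ha c y P hP Y hfire hperf
    (fun h hh => by have := hno h hh; omega) u
  rw [hu] at this
  exact Bool.noConfusion this

end Law

/-! ### §6 Corollary: sparse strategies with a cut-free window -/

section Sparse

variable {n : ℕ}

/-- **Sparse strategies with a window lose** (the perfect-strategy form of the cell's sparse rung).  If every cut
outside `S` never fires, every `y_g` has `𝔽_p`-degree `≤ d` (`p ≠ 3`), and `S` leaves a cut-free window of
`ℓ ≥ 3·#S·d + 2` bits, then the strategy loses at some input: the firing PATTERN classes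
`{u : y_g(u) = y_g(u₀) ∀ g ∈ S}` are level sets of degree `≤ #S·d` with constant, gapped fired sets. -/
theorem exists_loss_of_sparse_window (p : ℕ) [Fact p.Prime] (hp3 : p ≠ 3) {d a ℓ : ℕ} (c : ℕ)
    (y : Fin (n + 1) → (Fin n → Bool) → Bool) (S : Finset (Fin (n + 1)))
    (hsupp : ∀ g, g ∉ S → ∀ u, y g u = false) (hdeg : ∀ g, HasDegF p (y g) d)
    (hℓ : 3 * (S.card * d) + 2 ≤ ℓ) (ha : a + ℓ ≤ n) (hgap : ∀ h ∈ S, h.val ≤ a ∨ a + ℓ ≤ h.val) :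
    ∃ u, ringWinU c y u = false := by
  by_contra hno
  push Not at hno
  have hperf : ∀ u, ringWinU c y u = true := fun u => by
    cases h : ringWinU c y u
    · exact absurd h (hno u)
    · rfl
  -- the firing-pattern class of the zero input
  let u₀ : Fin n → Bool := fun _ => false
  let P : (Fin n → Bool) → Bool := fun u => decide (∀ g ∈ S, y g u = y g u₀)
  let Y : Finset (Fin (n + 1)) := S.filter fun g => y g u₀ = true
  have hPdeg : HasDegF p P (S.card * d) := by
    have heq : (fun u => if P u then (1 : ZMod p) else 0) =
        ∏ g ∈ S, (fun u => if y g u = y g u₀ then (1 : ZMod p) else 0) := by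
      funext u
      rw [Finset.prod_apply, Finset.prod_boole]
      simp only [P, decide_eq_true_eq]
      congr
    unfold HasDegF
    rw [heq]
    refine prod_mem_lowDeg S (fun g _ => ?_)
    cases h0 : y g u₀
    · have h1 : (fun u => if y g u = false then (1 : ZMod p) else 0) =
          1 - fun u => if y g u = true then (1 : ZMod p) else 0 := by
        funext u
        cases hyu : y g u <;> simp [hyu]
      rw [h1]
      exact Submodule.sub_mem _ (one_mem_lowDeg d) (hdeg g)
    · exact hdeg g
  have hfire : ∀ u, P u = true → ∀ g, (y g u = true ↔ g ∈ Y) := by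
    intro u hu g
    simp only [P, decide_eq_true_eq] at hu
    by_cases hg : g ∈ S
    · rw [hu g hg]
      simp [Y, hg]
    · have h0 := hsupp g hg u
      simp [Y, hg, h0]
  have hgapY : ∀ h ∈ Y, h.val ≤ a ∨ a + ℓ ≤ h.val := fun h hh => hgap h (Finset.mem_filter.1 hh).1
  have hall := levelSet_false_of_perfect_gap p hp3 hℓ ha c y P hPdeg Y hfire (fun u _ => hperf u) hgapY u₀
  have hP0 : P u₀ = true := by simp [P]
  rw [hall] at hP0
  exact Bool.false_ne_true hP0

end Sparse

end Summit.QuantumAdvantage.QuantumAdvantage.Theorems.GapLaw
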